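import Literature.Algebra.Module.FreenessByRankCount
import HarnessLib

/-!
# Crux `MazurTateCongruenceAtTwoTop` (stmt-BirchSwinnertonDyer-25797) = `MazurTateCongruenceAtTwoR` (21416): the algebraic
# core of VATSAL'S CONDITION 2 AT `p = 2` — multiplicity one + a residually NON-SCALAR involution make the Hecke module the
# REGULAR representation `𝕋_𝔪[C₂]`, so the invariant eigen-functionals form a line and congruent eigen-characters give
# congruent canonically normalised functionals (route-independent core, part 6; pure commutative algebra)

Cell `bsd-wall`, seat `bsd-wall-tp2-p1-w2` (WIDTH seat on the K1 row). THEOREMS ONLY (no `def`, no named fact, no `sorry`);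
no route file and no modular-form file is imported: this is the commutative algebra behind Vatsal 1999 §1 (1.2)–(1.6), isolated so
that the `p = 2` case is visible in the kernel.

WHY. The K1 row's research residue is (SP2) = the congruence mod `2` of the doubled, `S₀`-depleted, lattice-normalised plus
modular symbols of the newforms of `W` and of its theta partner `A` (lead tp2-p1 g10, `…ROfSymbolLaw`). In print (Vatsal 1999,
Greenberg–Vatsal 2000 §3) this is, for ODD `p`, the chain: multiplicity one for `J₀(M)[𝔪]` ⇒ `H = H₁(X₀(M), ℤ_p)_𝔪` free of
rank `2` over `𝕋_𝔪` ⇒ (p odd) `H^± = (1 ± c)/2 · H` free of rank `1` (CONDITION 2) ⇒ the `c`-invariant `λ_f`-eigen-functionals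
`H → ℤ_p` form a free `ℤ_p`-line whose primitive generator is congruent mod `p` to that of any `g` with `λ_g ≡ λ_f` ⇒ congruence
of canonically normalised plus symbols. At `p = 2` the projector `(1 ± c)/2` does not exist. THIS FILE proves that it is not
needed: if the involution `c` is NOT A SCALAR on `H/𝔪H` (for the complex conjugation on `J₀(M)[𝔪] ≅ ρ̄ = W[2]` this says
`c ≠ 1` on `W[2]`, i.e. `Δ_W < 0`, which holds on the whole habitat because the CM partner `A`, good supersingular at `2`,
has `j(A) ≤ 0 < 1728`), then Nakayama + the rank count give a `𝕋_𝔪`-basis of the form `(h, c h)`, i.e. `H ≅ 𝕋_𝔪[C₂]` is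
the REGULAR representation of `C₂ = ⟨c⟩` over `𝕋_𝔪` (§1); consequently (§2) for every ring map `σ : 𝕋_𝔪 → O` the
`c`-invariant `σ`-semilinear functionals `ψ : H → O` are exactly the multiples of ONE explicit functional
`ψ_σ(r₀h + r₁ch) = σ r₀ + σ r₁`, two such functionals for residually congruent `σ₁ ≡ σ₂ (mod I)` with a unit value are
congruent mod `I` up to a unit, and over `O = ℤ₂`, `I = (2)` (every unit is `≡ 1`) congruent on the nose (§3). Multiplicity one
mod `2` itself is the tree's named fact `buzzard2000_multiplicityOne_gamma0` (Buzzard 2000, Prop. 2.4: `ρ̄` irreducible and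
non-scalar on a decomposition group at `2` — automatic for good supersingular reduction at `2`); the freeness step is the
tree's PROVED `Literature.Algebra.Module.FreenessCriterion.basisOfRankCriterion`.

WHAT IS PROVED (all unconditional, any commutative rings):
* §0 `exists_span_pair_eq_top_of_forall_ne_smul` — over a field `k`, an endomorphism `c` of a plane `V` (`finrank = 2`) that
  is not a scalar admits a vector `v` with `(v, c v)` spanning `V`.
* §1 `exists_span_sup_smul_top_eq_top_of_not_residuallyScalar` (Nakayama form over a local ring `A`: if `M/𝔪M` is a plane on
  which `c` is not a scalar then some `(v, c v)` generates `M` modulo `𝔪M`) and the basis theorem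
  `exists_basis_pair_self_conj`: if moreover `A` is finite free over a domain `R` and `2 · rank_R A ≤ rank_R M`, then `M` has an
  `A`-basis `b` with `b 1 = c (b 0)` — `M ≅ A[C₂]` when `c² = 1`. Corollary `ker_sub_one_eq_span_add` (the `c`-invariants are
  the free line `A · (b 0 + b 1)`: Condition 2 for the sign `+`; `−` is symmetric).
* §2 for a basis `b` with `b 1 = c (b 0)`, `c (b 1) = b 0` and a ring map `σ : A →+* O`: every `c`-invariant `σ`-semilinear
  `ψ : M →ₛₗ[σ] O` satisfies `ψ x = ψ (b 0) · (σ (b.repr x 0) + σ (b.repr x 1))` (`apply_eq_mul_of_invariant`); the explicit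
  invariant functional exists (`exists_invariant_functional`); congruence of the explicit functionals for `σ₁ ≡ σ₂ mod I`
  (`canonical_sub_mem`), hence of any two invariant functionals with a unit value, up to a unit (`exists_unit_sub_mem`) and,
  when all units are `≡ 1 mod I`, on the nose (`sub_mem_of_units_sub_one_mem`); §3 the `ℤ₂` specialisation
  (`padicInt_two_units_sub_one_mem`, `sub_mem_span_two`).

DICTIONARY (for the K1 row; NOT formalised here — see the seat's memo VATSAL-AT-TWO-PLAN): `R = ℤ₂`, `A = 𝕋_𝔪` (the completed
Hecke algebra of `S₂(Γ₀(M))`, `M = lcm`-level of the two `S₀`-depleted newforms, at the non-Eisenstein `𝔪 ∋ 2` of `ρ̄ = W[2]`),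
`M = H₁(X₀(M), ℤ)⊗ℤ₂` localised at `𝔪`, `c` = complex conjugation `z ↦ -z̄`, `σᵢ = λ_{f°_W}, λ_{f°_A} : 𝕋_𝔪 → ℤ₂`,
`ψᵢ(γ) = 2 Re ∫_γ 2πi f°ᵢ dz / Ω⁺`; the hypotheses come from: `finrank = 2` ⟸ Buzzard's multiplicity one + the Hecke-self-adjoint
perfect pairing (tree facts); rank count ⟸ Eichler–Shimura; non-scalar ⟸ `Δ_W < 0`; unit value ⟸ the lattice normalisation
`(1 + c)Λ_f = ℤ·Ω⁺_f` (+ Ihara at the depletion primes — the one input printed for odd `p` only). BSD is not proved by any of this;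
the crux is not closed by this file.

References: V. Vatsal, Duke Math. J. 98 (1999) §1 (1.2)–(1.6), Thm. (1.13) [Vatsal1999]; R. Greenberg, V. Vatsal, Invent. Math.
142 (2000) §3 (17)–(19) [GreenbergVatsal2000]; K. Buzzard, Math. Res. Lett. 7 (2000) Prop. 2.4 [Buzzard2000LevelLoweringModTwo];
H. Matsumura, Commutative Ring Theory, Thm. 2.3 [Matsumura1987].
-/

set_option linter.dupNamespace false
set_option autoImplicit false

noncomputable section

open Module Function Submodule

namespace Summit.BirchSwinnertonDyer.BirchSwinnertonDyer.Theorems.MazurTateCongruenceAtTwoR.ConditionTwo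

/-! ### §0 Linear algebra over a field: a non-scalar endomorphism of a plane has a cyclic vector -/

section Field

variable {k V : Type*} [Field k] [AddCommGroup V] [Module k V]

/-- If every vector of a plane is an eigenvector of `c`, then `c` is a scalar. Contrapositive, constructive half: if `c` is not
a scalar (`c ≠ a • id` for every `a`), some `v` has `c v ∉ k ∙ v`. [folklore] -/
theorem exists_apply_not_mem_span_singleton_of_forall_ne_smul [FiniteDimensional k V] (h2 : finrank k V = 2)
    (c : V →ₗ[k] V) (hc : ∀ a : k, c ≠ a • LinearMap.id) : ∃ v : V, c v ∉ k ∙ v := by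
  by_contra! H
  let b : Basis (Fin 2) k V := Module.finBasisOfFinrankEq k V h2
  obtain ⟨a₀, ha₀⟩ := mem_span_singleton.mp (H (b 0))
  obtain ⟨a₁, ha₁⟩ := mem_span_singleton.mp (H (b 1))
  obtain ⟨d, hd⟩ := mem_span_singleton.mp (H (b 0 + b 1))
  -- compare coordinates of `c (b 0 + b 1) = a₀ b 0 + a₁ b 1 = d b 0 + d b 1`
  have hsum : a₀ • b 0 + a₁ • b 1 = d • b 0 + d • b 1 := by
    rw [ha₀, ha₁, ← map_add, ← hd, smul_add]
  have hcoord := congrArg (fun x ↦ b.repr x) hsum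
  have h0 : a₀ = d := by
    have := congrArg (fun f ↦ f 0) hcoord
    simpa [Finsupp.add_apply, b.repr_self, Finsupp.single_apply] using this
  have h1 : a₁ = d := by
    have := congrArg (fun f ↦ f 1) hcoord
    simpa [Finsupp.add_apply, b.repr_self, Finsupp.single_apply] using this
  refine hc d (b.ext fun i ↦ ?_)
  fin_cases i
  · simpa [← h0] using ha₀.symm
  · simpa [← h1] using ha₁.symm

/-- If `c v ∉ k ∙ v` then `(v, c v)` is a linearly independent pair. [folklore] -/
theorem linearIndependent_pair_of_apply_not_mem_span_singleton (c : V →ₗ[k] V) {v : V} (hv : c v ∉ k ∙ v) :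
    LinearIndependent k ![v, c v] := by
  rw [LinearIndependent.pair_iff]
  intro s t hst
  have hv0 : v ≠ 0 := by
    rintro rfl
    exact hv (by simp)
  by_cases ht : t = 0
  · subst ht
    simp only [zero_smul, add_zero] at hst
    exact ⟨(smul_eq_zero.mp hst).resolve_right hv0, rfl⟩
  · exfalso
    apply hv
    rw [mem_span_singleton]
    refine ⟨-(t⁻¹ * s), ?_⟩
    have : t • c v = -(s • v) := eq_neg_of_add_eq_zero_right hst
    calc -(t⁻¹ * s) • v = t⁻¹ • (-(s • v)) := by rw [neg_smul, mul_smul, smul_neg]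
      _ = t⁻¹ • (t • c v) := by rw [this]
      _ = c v := by rw [smul_smul, inv_mul_cancel₀ ht, one_smul]

/-- **A non-scalar endomorphism of a plane has a cyclic vector**: if `finrank_k V = 2` and `c ≠ a • id` for every `a ∈ k`,
then some `v` has `span {v, c v} = V`. [folklore] -/
theorem exists_span_pair_eq_top_of_forall_ne_smul [FiniteDimensional k V] (h2 : finrank k V = 2) (c : V →ₗ[k] V)
    (hc : ∀ a : k, c ≠ a • LinearMap.id) : ∃ v : V, span k (Set.range ![v, c v]) = ⊤ := by
  obtain ⟨v, hv⟩ := exists_apply_not_mem_span_singleton_of_forall_ne_smul h2 c hc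
  exact ⟨v, (linearIndependent_pair_of_apply_not_mem_span_singleton c hv).span_eq_top_of_card_eq_finrank'
    (by simp [h2])⟩

end Field

/-! ### §1 Over a local ring: Nakayama form and the regular basis `(h, c h)` -/

section Local

variable {A M : Type*} [CommRing A] [IsLocalRing A] [AddCommGroup M] [Module A M]

open IsLocalRing

/-- The reduction of an `A`-linear endomorphism to `M/𝔪M` (as an `A`-linear map). [folklore] -/
theorem smul_top_le_comap (c : M →ₗ[A] M) :
    maximalIdeal A • (⊤ : Submodule A M) ≤ (maximalIdeal A • (⊤ : Submodule A M)).comap c := by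
  rw [← map_le_iff_le_comap, map_smul'']
  exact smul_mono_right _ le_top

/-- **Nakayama form.** Let `A` be local with maximal ideal `𝔪` and residue field `k = A/𝔪`, `M` a finite `A`-module with
`dim_k M/𝔪M = 2`, and `c` an `A`-linear endomorphism of `M` which is NOT residually a scalar: for every `a ∈ A` some `z` has
`c z − a z ∉ 𝔪M`. Then there is `v ∈ M` such that `v, c v` generate `M` modulo `𝔪M`. [folklore] -/
theorem exists_span_sup_smul_top_eq_top_of_not_residuallyScalar [Module.Finite A M]
    (h2 : finrank (A ⧸ maximalIdeal A) (M ⧸ maximalIdeal A • (⊤ : Submodule A M)) = 2) (c : M →ₗ[A] M)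
    (hc : ∀ a : A, ∃ z : M, c z - a • z ∉ maximalIdeal A • (⊤ : Submodule A M)) :
    ∃ v : M, span A (Set.range ![v, c v]) ⊔ maximalIdeal A • (⊤ : Submodule A M) = ⊤ := by
  classical
  letI : Field (A ⧸ maximalIdeal A) := Ideal.Quotient.field _
  set N : Submodule A M := maximalIdeal A • (⊤ : Submodule A M) with hN
  -- the reduction `c̄` of `c`, first `A`-linear, then `k`-linear
  let cA : (M ⧸ N) →ₗ[A] (M ⧸ N) := N.mapQ N c (smul_top_le_comap c)
  have hcA : ∀ z : M, cA (N.mkQ z) = N.mkQ (c z) := fun z ↦ rfl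
  let ck : (M ⧸ N) →ₗ[A ⧸ maximalIdeal A] (M ⧸ N) :=
    LinearMap.extendScalarsOfSurjective Ideal.Quotient.mk_surjective cA
  have hck : ∀ x, ck x = cA x := fun x ↦ rfl
  -- `c̄` is not a scalar
  have hck' : ∀ a : A ⧸ maximalIdeal A, ck ≠ a • LinearMap.id := by
    intro a ha
    obtain ⟨a, rfl⟩ := Ideal.Quotient.mk_surjective a
    obtain ⟨z, hz⟩ := hc a
    apply hz
    have h1 : ck (N.mkQ z) = (Ideal.Quotient.mk (maximalIdeal A) a) • N.mkQ z := by
      rw [ha]; rfl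
    rw [hck, hcA] at h1
    have h2' : (Ideal.Quotient.mk (maximalIdeal A) a) • N.mkQ z = N.mkQ (a • z) := by
      rw [← Ideal.Quotient.algebraMap_eq, algebraMap_smul, map_smul]
    rw [h2', ← sub_eq_zero, ← map_sub, Submodule.mkQ_apply, Submodule.Quotient.mk_eq_zero] at h1
    exact h1
  haveI : FiniteDimensional (A ⧸ maximalIdeal A) (M ⧸ N) := Module.finite_of_finrank_eq_succ h2
  obtain ⟨vbar, hv⟩ := exists_span_pair_eq_top_of_forall_ne_smul h2 ck hck'
  obtain ⟨v, rfl⟩ := N.mkQ_surjective vbar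
  refine ⟨v, ?_⟩
  -- `span_A {v, c v} ⊔ N = ⊤ ⟸ span_k {v̄, c̄ v̄} = ⊤`
  rw [sup_comm, ← Submodule.map_mkQ_eq_top, Submodule.map_span]
  have hset : (N.mkQ : M → M ⧸ N) '' Set.range ![v, c v] = Set.range ![N.mkQ v, ck (N.mkQ v)] := by
    rw [← Set.range_comp]
    congr 1
    ext i
    fin_cases i
    · rfl
    · show N.mkQ (c v) = ck (N.mkQ v)
      rw [hck, hcA]
  rw [hset]
  have := Submodule.restrictScalars_span A (A ⧸ maximalIdeal A) Ideal.Quotient.mk_surjective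
    (Set.range ![N.mkQ v, ck (N.mkQ v)])
  rw [← this, hv, Submodule.restrictScalars_top]

variable {R : Type*} [CommRing R] [IsDomain R] [Algebra R A] [Module R M] [IsScalarTower R A M]

/-- **Vatsal's Condition 2 at `p = 2`, algebraic core: the regular basis.** Let `A` be a commutative LOCAL ring, finite free
over a domain `R` (`𝕋_𝔪` over `ℤ₂`), `M` a finite `A`-module with `dim_k M/𝔪M = 2` (MULTIPLICITY ONE) and
`2 · rank_R A ≤ rank_R M` (Eichler–Shimura rank count), and `c` an `A`-linear endomorphism of `M` which is not residually a
scalar. Then `M` has an `A`-basis `(b 0, b 1)` with `b 1 = c (b 0)`; in particular `M` is free of rank `2` and, when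
`c² = 1`, `M ≅ A[C₂]` is the regular representation. [cite: Vatsal1999, §1 (1.2) Condition 2 and Thm. (1.13) — the p = 2
mechanism; algebra proved here] -/
theorem exists_basis_pair_self_conj [Module.Free R A] [Module.Finite R A] [Module.Finite A M]
    (h2 : finrank (A ⧸ maximalIdeal A) (M ⧸ maximalIdeal A • (⊤ : Submodule A M)) = 2) (c : M →ₗ[A] M)
    (hc : ∀ a : A, ∃ z : M, c z - a • z ∉ maximalIdeal A • (⊤ : Submodule A M))
    (hrank : 2 * finrank R A ≤ finrank R M) :
    ∃ b : Basis (Fin 2) A M, b 1 = c (b 0) := by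
  obtain ⟨v, hv⟩ := exists_span_sup_smul_top_eq_top_of_not_residuallyScalar h2 c hc
  have hne : maximalIdeal A ≠ ⊤ := (maximalIdeal.isMaximal A).ne_top
  let b := Literature.Algebra.Module.FreenessCriterion.basisOfRankCriterion (R := R) hne ![v, c v] hv hrank
  have hb : ∀ i, b i = ![v, c v] i := fun i ↦ by
    simp [b, Literature.Algebra.Module.FreenessCriterion.basisOfRankCriterion, Basis.coe_ofEquivFun,
      Fintype.linearCombination_apply_single]
  exact ⟨b, by rw [hb 0, hb 1]; simp⟩

omit [IsLocalRing A] in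
/-- **Condition 2 for the sign `+` (and, symmetrically, `−`).** For an `A`-basis `(b 0, b 1)` with `c (b 0) = b 1` and
`c (b 1) = b 0`, the `c`-invariants `ker (c − 1)` are the line `A · (b 0 + b 1)`, and this line is free
(`r · (b 0 + b 1) = 0 ⇒ r = 0`). [cite: Vatsal1999, §1 (1.2) Condition 2; proved here] -/
theorem ker_sub_one_eq_span_add (b : Basis (Fin 2) A M) (c : M →ₗ[A] M) (h0 : c (b 0) = b 1) (h1 : c (b 1) = b 0) :
    LinearMap.ker (c - LinearMap.id) = A ∙ (b 0 + b 1) ∧ ∀ r : A, r • (b 0 + b 1) = 0 → r = 0 := by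
  constructor
  · ext x
    rw [LinearMap.mem_ker, LinearMap.sub_apply, LinearMap.id_apply, sub_eq_zero, mem_span_singleton]
    constructor
    · intro hx
      -- write `x = r₀ b 0 + r₁ b 1`; `c x = r₀ b 1 + r₁ b 0 = x` forces `r₀ = r₁`
      have hx' := b.linearCombination_repr x
      rw [Finsupp.linearCombination_apply, Finsupp.sum_fintype _ _ (by simp), Fin.sum_univ_two] at hx'
      have hcx : c x = b.repr x 0 • b 1 + b.repr x 1 • b 0 := by
        conv_lhs => rw [← hx']
        rw [map_add, map_smul, map_smul, h0, h1]
      rw [hcx] at hx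
      have hcoord := congrArg (fun y ↦ b.repr y 0) hx
      simp only [map_add, map_smul, b.repr_self, Finsupp.smul_apply, Finsupp.single_apply, Finsupp.add_apply,
        smul_eq_mul] at hcoord
      norm_num at hcoord
      refine ⟨b.repr x 0, ?_⟩
      have hsplit : b.repr x 0 • (b 0 + b 1) = b.repr x 0 • b 0 + b.repr x 1 • b 1 := by
        rw [hcoord, smul_add]
      rw [hsplit, hx']
    · rintro ⟨r, rfl⟩
      rw [map_smul, map_add, h0, h1, add_comm]
  · intro r hr
    have := congrArg (fun y ↦ b.repr y 0) hr
    simpa [b.repr_self, Finsupp.single_apply] using this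

end Local

/-! ### §2 Invariant semilinear functionals on the regular representation -/

section Functionals

variable {A O M : Type*} [CommRing A] [CommRing O] [AddCommGroup M] [Module A M]

/-- Coordinates on a basis `(b 0, b 1)`: `x = (b.repr x 0) • b 0 + (b.repr x 1) • b 1`. [folklore] -/
theorem eq_repr_zero_smul_add_repr_one_smul (b : Basis (Fin 2) A M) (x : M) :
    x = b.repr x 0 • b 0 + b.repr x 1 • b 1 := by
  have hx := b.linearCombination_repr x
  rw [Finsupp.linearCombination_apply, Finsupp.sum_fintype _ _ (by simp), Fin.sum_univ_two] at hx
  exact hx.symm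

/-- On the regular basis, `c` SWAPS the coordinates. [folklore] -/
theorem repr_conj_eq (b : Basis (Fin 2) A M) (c : M →ₗ[A] M) (h0 : c (b 0) = b 1) (h1 : c (b 1) = b 0) (x : M) :
    b.repr (c x) 0 = b.repr x 1 ∧ b.repr (c x) 1 = b.repr x 0 := by
  have hcx : c x = b.repr x 0 • b 1 + b.repr x 1 • b 0 := by
    conv_lhs => rw [eq_repr_zero_smul_add_repr_one_smul b x]
    rw [map_add, map_smul, map_smul, h0, h1]
  constructor <;>
  · rw [hcx]
    simp [b.repr_self]

/-- **Invariant functionals are multiples of the canonical one.** For a basis with `c (b 0) = b 1` and a ring map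
`σ : A →+* O`, every `σ`-semilinear `ψ : M → O` with `ψ ∘ c = ψ` satisfies
`ψ x = ψ (b 0) · (σ (b.repr x 0) + σ (b.repr x 1))`. (Vatsal: `δ⁺_f = ` the element of `H⁺_𝔪 ≅ 𝕋_𝔪^*` corresponding to
`λ_f`, up to the canonical period.) [cite: Vatsal1999, §1 (1.3) displays (3)–(5); algebra proved here] -/
theorem apply_eq_mul_of_invariant (b : Basis (Fin 2) A M) (c : M →ₗ[A] M) (h0 : c (b 0) = b 1) {σ : A →+* O}
    (ψ : M →ₛₗ[σ] O) (hψ : ∀ x, ψ (c x) = ψ x) (x : M) :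
    ψ x = ψ (b 0) * (σ (b.repr x 0) + σ (b.repr x 1)) := by
  have hb1 : ψ (b 1) = ψ (b 0) := by rw [← h0, hψ]
  conv_lhs => rw [eq_repr_zero_smul_add_repr_one_smul b x]
  rw [map_add, LinearMap.map_smulₛₗ, LinearMap.map_smulₛₗ, hb1, smul_eq_mul, smul_eq_mul]
  ring

/-- **The canonical invariant functional exists**: `ψ_σ x = σ (b.repr x 0) + σ (b.repr x 1)` is `σ`-semilinear,
`c`-invariant (the coordinates swap) and takes the value `1` at `b 0`. [cite: Vatsal1999, §1 (1.3); proved here] -/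
theorem exists_invariant_functional (b : Basis (Fin 2) A M) (c : M →ₗ[A] M) (h0 : c (b 0) = b 1) (h1 : c (b 1) = b 0)
    (σ : A →+* O) :
    ∃ ψ : M →ₛₗ[σ] O, (∀ x, ψ (c x) = ψ x) ∧ ψ (b 0) = 1 ∧ ∀ x, ψ x = σ (b.repr x 0) + σ (b.repr x 1) := by
  let φ : (Fin 2 →₀ A) →ₗ[A] A := Finsupp.lapply 0 + Finsupp.lapply 1
  let ψA : M →ₗ[A] A := φ ∘ₗ (b.repr : M →ₗ[A] (Fin 2 →₀ A))
  have hψA : ∀ x, ψA x = b.repr x 0 + b.repr x 1 := fun x ↦ rfl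
  let ψ : M →ₛₗ[σ] O := σ.toSemilinearMap ∘ₛₗ ψA
  have hψ : ∀ x, ψ x = σ (b.repr x 0) + σ (b.repr x 1) := fun x ↦ by
    show σ (ψA x) = _
    rw [hψA, map_add]
  refine ⟨ψ, fun x ↦ ?_, ?_, hψ⟩
  · obtain ⟨e0, e1⟩ := repr_conj_eq b c h0 h1 x
    rw [hψ, hψ, e0, e1, add_comm]
  · rw [hψ]
    simp [b.repr_self]

/-- **Congruent characters give congruent canonical functionals**: if `σ₁ a − σ₂ a ∈ I` for all `a`, then
`ψ_{σ₁} x − ψ_{σ₂} x ∈ I` for all `x`. (Vatsal (1.3) display (4): «since `f ≡ g (mod π^r)` we will have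
`δ^±_f ≡ δ^±_g (mod π^r)`».) [cite: Vatsal1999, §1 (1.3) display (4); algebra proved here] -/
theorem canonical_sub_mem (b : Basis (Fin 2) A M) {σ₁ σ₂ : A →+* O} (I : Ideal O) (hσ : ∀ a, σ₁ a - σ₂ a ∈ I) (x : M) :
    (σ₁ (b.repr x 0) + σ₁ (b.repr x 1)) - (σ₂ (b.repr x 0) + σ₂ (b.repr x 1)) ∈ I := by
  have : (σ₁ (b.repr x 0) + σ₁ (b.repr x 1)) - (σ₂ (b.repr x 0) + σ₂ (b.repr x 1)) =
      (σ₁ (b.repr x 0) - σ₂ (b.repr x 0)) + (σ₁ (b.repr x 1) - σ₂ (b.repr x 1)) := by ring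
  rw [this]
  exact I.add_mem (hσ _) (hσ _)

/-- An invariant functional with a unit value SOMEWHERE has a unit value at `b 0` (its value at `b 0` divides every value).
(Vatsal, Remark (1.12): the canonically normalised symbol is a unit somewhere.) [cite: Vatsal1999, Remark (1.12); proved here] -/
theorem isUnit_apply_basis_of_isUnit_apply (b : Basis (Fin 2) A M) (c : M →ₗ[A] M) (h0 : c (b 0) = b 1) {σ : A →+* O}
    (ψ : M →ₛₗ[σ] O) (hψ : ∀ x, ψ (c x) = ψ x) {x₀ : M} (hx₀ : IsUnit (ψ x₀)) : IsUnit (ψ (b 0)) := by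
  rw [apply_eq_mul_of_invariant b c h0 ψ hψ x₀] at hx₀
  exact isUnit_of_mul_isUnit_left hx₀

/-- **Congruence of invariant eigen-functionals up to a unit.** On the regular basis, two `c`-invariant functionals
`ψ₁` (`σ₁`-semilinear) and `ψ₂` (`σ₂`-semilinear) with `σ₁ ≡ σ₂ (mod I)`, each with a unit value somewhere, satisfy
`ψ₁ ≡ u · ψ₂ (mod I)` for a unit `u ∈ O×`. (Vatsal (1.6): «`Δ^±_f ≡ Δ^±_g (mod π^r)`», the canonical periods being
«only determined up to p-adic units».) [cite: Vatsal1999, §1 (1.3)–(1.6); algebra proved here] -/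
theorem exists_unit_sub_mem (b : Basis (Fin 2) A M) (c : M →ₗ[A] M) (h0 : c (b 0) = b 1) {σ₁ σ₂ : A →+* O}
    (I : Ideal O) (hσ : ∀ a, σ₁ a - σ₂ a ∈ I) (ψ₁ : M →ₛₗ[σ₁] O) (ψ₂ : M →ₛₗ[σ₂] O) (hψ₁ : ∀ x, ψ₁ (c x) = ψ₁ x)
    (hψ₂ : ∀ x, ψ₂ (c x) = ψ₂ x) {x₁ x₂ : M} (hu₁ : IsUnit (ψ₁ x₁)) (hu₂ : IsUnit (ψ₂ x₂)) :
    ∃ u : Oˣ, ∀ x, ψ₁ x - u * ψ₂ x ∈ I := by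
  obtain ⟨u₁, hu₁'⟩ := isUnit_apply_basis_of_isUnit_apply b c h0 ψ₁ hψ₁ hu₁
  obtain ⟨u₂, hu₂'⟩ := isUnit_apply_basis_of_isUnit_apply b c h0 ψ₂ hψ₂ hu₂
  refine ⟨u₁ * u₂⁻¹, fun x ↦ ?_⟩
  rw [apply_eq_mul_of_invariant b c h0 ψ₁ hψ₁ x, apply_eq_mul_of_invariant b c h0 ψ₂ hψ₂ x, ← hu₁', ← hu₂']
  have : (u₁ : O) * (σ₁ (b.repr x 0) + σ₁ (b.repr x 1)) - ↑(u₁ * u₂⁻¹) * (↑u₂ * (σ₂ (b.repr x 0) + σ₂ (b.repr x 1))) =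
      u₁ * ((σ₁ (b.repr x 0) + σ₁ (b.repr x 1)) - (σ₂ (b.repr x 0) + σ₂ (b.repr x 1))) := by
    rw [Units.val_mul]
    linear_combination (-((u₁ : O) * (σ₂ (b.repr x 0) + σ₂ (b.repr x 1)))) * Units.inv_mul u₂
  rw [this]
  exact I.mul_mem_left _ (canonical_sub_mem b I hσ x)

/-- **Congruence on the nose when every unit is `≡ 1 (mod I)`** (e.g. `O = ℤ₂`, `I = (2)`): under the hypotheses of
`exists_unit_sub_mem`, `ψ₁ x − ψ₂ x ∈ I` for every `x`. [cite: Vatsal1999, §1 (1.6); algebra proved here] -/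
theorem sub_mem_of_units_sub_one_mem (b : Basis (Fin 2) A M) (c : M →ₗ[A] M) (h0 : c (b 0) = b 1) {σ₁ σ₂ : A →+* O}
    (I : Ideal O) (hI : ∀ u : Oˣ, (u : O) - 1 ∈ I) (hσ : ∀ a, σ₁ a - σ₂ a ∈ I) (ψ₁ : M →ₛₗ[σ₁] O)
    (ψ₂ : M →ₛₗ[σ₂] O) (hψ₁ : ∀ x, ψ₁ (c x) = ψ₁ x) (hψ₂ : ∀ x, ψ₂ (c x) = ψ₂ x) {x₁ x₂ : M}
    (hu₁ : IsUnit (ψ₁ x₁)) (hu₂ : IsUnit (ψ₂ x₂)) (x : M) : ψ₁ x - ψ₂ x ∈ I := by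
  obtain ⟨u, hu⟩ := exists_unit_sub_mem b c h0 I hσ ψ₁ ψ₂ hψ₁ hψ₂ hu₁ hu₂
  have : ψ₁ x - ψ₂ x = (ψ₁ x - u * ψ₂ x) + ((u : O) - 1) * ψ₂ x := by ring
  rw [this]
  exact I.add_mem (hu x) (I.mul_mem_right _ (hI u))

end Functionals

/-! ### §3 The `ℤ₂` specialisation: every `2`-adic unit is `≡ 1 (mod 2)` -/

section PadicTwo

/-- Every unit of `ℤ₂` is `≡ 1 (mod 2)`. [folklore] -/
theorem padicInt_two_units_sub_one_mem (u : ℤ_[2]ˣ) : (u : ℤ_[2]) - 1 ∈ Ideal.span {(2 : ℤ_[2])} := by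
  have hker : (u : ℤ_[2]) - 1 ∈ RingHom.ker (PadicInt.toZMod (p := 2)) := by
    rw [RingHom.mem_ker, map_sub, map_one, sub_eq_zero]
    have hunit : IsUnit (PadicInt.toZMod (p := 2) (u : ℤ_[2])) := (Units.isUnit u).map _
    have h01 : ∀ a : ZMod 2, a = 0 ∨ a = 1 := by decide
    rcases h01 (PadicInt.toZMod (p := 2) (u : ℤ_[2])) with h | h
    · rw [h] at hunit; exact absurd hunit not_isUnit_zero
    · exact h
  rw [PadicInt.ker_toZMod, PadicInt.maximalIdeal_eq_span_p] at hker
  simpa using hker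

variable {A M : Type*} [CommRing A] [AddCommGroup M] [Module A M]

/-- **The K1-row form.** On the regular basis `(b 0, b 1 = c b 0)`, two `c`-invariant functionals `ψᵢ : M → ℤ₂`,
`σᵢ`-semilinear for characters `σ₁ ≡ σ₂ (mod 2)` (`𝕋_𝔪 → ℤ₂`, the eigen-characters of the two depleted newforms) and each
with a unit value somewhere (primitive normalisation), are congruent mod `2` value by value: `ψ₁ x − ψ₂ x ∈ 2ℤ₂`.
[cite: Vatsal1999, §1 (1.6); GreenbergVatsal2000, §3 (19); algebra proved here] -/
theorem sub_mem_span_two (b : Basis (Fin 2) A M) (c : M →ₗ[A] M) (h0 : c (b 0) = b 1) {σ₁ σ₂ : A →+* ℤ_[2]}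
    (hσ : ∀ a, σ₁ a - σ₂ a ∈ Ideal.span {(2 : ℤ_[2])}) (ψ₁ : M →ₛₗ[σ₁] ℤ_[2]) (ψ₂ : M →ₛₗ[σ₂] ℤ_[2])
    (hψ₁ : ∀ x, ψ₁ (c x) = ψ₁ x) (hψ₂ : ∀ x, ψ₂ (c x) = ψ₂ x) {x₁ x₂ : M} (hu₁ : IsUnit (ψ₁ x₁))
    (hu₂ : IsUnit (ψ₂ x₂)) (x : M) : ψ₁ x - ψ₂ x ∈ Ideal.span {(2 : ℤ_[2])} :=
  sub_mem_of_units_sub_one_mem b c h0 _ padicInt_two_units_sub_one_mem hσ ψ₁ ψ₂ hψ₁ hψ₂ hu₁ hu₂ x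

end PadicTwo

end Summit.BirchSwinnertonDyer.BirchSwinnertonDyer.Theorems.MazurTateCongruenceAtTwoR.ConditionTwo

end
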